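import Summits.ValiantsHypothesis.ValiantsHypothesis.Theorems.KPlusLogSqLawTridiagonalRealStaticUnitRecessiveCount

/-!
# Route «KPlusLogSqLaw», crux `WeakLifting` (stmt-ValiantsHypothesis-19561) — REAL side of the tridiagonal sector:
# the UNIT-COEFFICIENT sub-sector — the recessive count law for ALL sizes (NJAN-free zeros) and in the census currency (DISTINCT zeros)

HONEST FRAMING.  Helper theorems (`--supports stmt-ValiantsHypothesis-19561 --as helper`), seat val-sym-lift-p1 (g18), cell `pub-symmetroid`,
2026-08-28; companion of `…UnitRecessiveCount` (p638066).  Continuants `D_k = pathDet (fun _ => 1) d (fun _ => 1) f k`, all slopes positive.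
Proved here (all exponents):
* `card_roots_below_eq_sturm`, **`card_roots_unit_interval_eq_div_three_of_sep`** (ALL sizes `m ≥ 3`): if every zero of `D_m` in `(0,1)` is
  non-degenerate and has no two negative pivot products three edges apart («no N J A N»), the zeros in `(0,1)` counted with multiplicity number
  EXACTLY `⌊m/3⌋` (the hypothesis is automatic for `m ≤ 8` and genuinely needed from `m = 9` on: memo CROSSING-DIRECTION-liftp1g18.md §3);
* `rootMultiplicity_eq_one_of_le_eight` — for `m ≤ 8` every non-degenerate zero in `(0,1)` is SIMPLE (derivative-sign law of `…UnitWronskian`);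
* **`card_posRoots_unit_interval_eq_div_three`** — the census currency: for `3 ≤ m ≤ 8` the DISTINCT zeros of `D_m` in `(0,1)` number exactly `⌊m/3⌋`
  (one-signed slopes, non-degenerate zeros), i.e. the recessive side of the unit row `U m` is `⌊m/3⌋` on the one-signed class.
Nothing here is an upper law for the register (α NO MOVER); nothing bears on `WeakLifting` / `TropicalB` (stmt-19771) in their windows, Conjecture B,
the Door-A registers, `MatrixDescartes` (stmt-18050) or VP ≠ VNP.
[this seat; folklore: Sturm sequences, simple roots]
-/

-- `Summit.ValiantsHypothesis.ValiantsHypothesis.…` repeats a component by the D-0017 layout (single-conjunct summit); the name is mandated.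
set_option linter.dupNamespace false
set_option autoImplicit false

namespace Summit.ValiantsHypothesis.ValiantsHypothesis.Theorems.KPlusLogSqLaw
namespace StaticTridiagonalRealUnit

open Real Finset Polynomial Filter Topology
open Summit.ValiantsHypothesis.ValiantsHypothesis.Theorems.KPlusLogSqLaw.StaticTridiagonalRealPotential (pathDet)

variable (d : ℕ → ℕ) (f : ℕ → ℕ)

/-! ### 1. The general-size count law under the separation hypothesis -/

/-- **zeros below a scale = Sturm count (all sizes, NJAN-free zeros)**. [this file] -/
theorem card_roots_below_eq_sturm (m : ℕ) (hm : 3 ≤ m) {b : ℝ} (hb0 : 0 < b) (hb1 : b < 1)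
    (hslope : ∀ k, k + 1 < m → d k + d (k + 1) < 2 * f k)
    (hb : ∀ k, k ≤ m → (pathDet (fun _ => (1 : ℝ)) d (fun _ => (1 : ℝ)) f k).eval b ≠ 0)
    (hnd : ∀ t, 0 < t → t < b → (pathDet (fun _ => (1 : ℝ)) d (fun _ => (1 : ℝ)) f m).eval t = 0 →
      ∀ k, 0 < k → k < m → (pathDet (fun _ => (1 : ℝ)) d (fun _ => (1 : ℝ)) f k).eval t ≠ 0)
    (hsep : ∀ t, 0 < t → t < b → (pathDet (fun _ => (1 : ℝ)) d (fun _ => (1 : ℝ)) f m).eval t = 0 → ∀ k, k + 4 < m →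
      (pathDet (fun _ => (1 : ℝ)) d (fun _ => (1 : ℝ)) f k).eval t * (pathDet (fun _ => (1 : ℝ)) d (fun _ => (1 : ℝ)) f (k + 1)).eval t < 0 →
      0 < (pathDet (fun _ => (1 : ℝ)) d (fun _ => (1 : ℝ)) f (k + 3)).eval t * (pathDet (fun _ => (1 : ℝ)) d (fun _ => (1 : ℝ)) f (k + 4)).eval t) :
    Multiset.card ((pathDet (fun _ => (1 : ℝ)) d (fun _ => (1 : ℝ)) f m).roots.filter (fun t => 0 < t ∧ t < b)) =
      (Finset.univ.filter fun k : Fin m =>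
          (pathDet (fun _ => (1 : ℝ)) d (fun _ => (1 : ℝ)) f k).eval b * (pathDet (fun _ => (1 : ℝ)) d (fun _ => (1 : ℝ)) f (k + 1)).eval b < 0).card := by
  set a := b / 4 with ha_def
  have ha0 : 0 < a := by rw [ha_def]; positivity
  have ha4 : a ≤ 1 / 4 := by rw [ha_def]; linarith
  have hab : a < b := by rw [ha_def]; linarith
  have hposA : ∀ x, 0 < x → x ≤ a → ∀ k, k ≤ m → 0 < (pathDet (fun _ => (1 : ℝ)) d (fun _ => (1 : ℝ)) f k).eval x := by
    intro x hx hxa k hk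
    rcases Nat.eq_zero_or_pos k with rfl | hk0
    · rw [(eval_unit_zero_one d f x).1]; exact one_pos
    · obtain ⟨k', rfl⟩ : ∃ k', k = k' + 1 := ⟨k - 1, by omega⟩
      exact (continuant_pos_of_le_quarter d f m x hx (hxa.trans ha4) hslope k' (by omega)).1
  have hwin := card_roots_window_add_sturm_eq d f m hm ha0 hab hb1 hslope
    (fun k hk => (hposA a ha0 le_rfl k hk).ne') hb (fun t hat htb => hnd t (ha0.trans hat) htb)
    (fun t hat htb => hsep t (ha0.trans hat) htb)
  have hVa : (Finset.univ.filter fun k : Fin m =>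
      (pathDet (fun _ => (1 : ℝ)) d (fun _ => (1 : ℝ)) f k).eval a * (pathDet (fun _ => (1 : ℝ)) d (fun _ => (1 : ℝ)) f (k + 1)).eval a < 0).card = 0 := by
    rw [Finset.card_eq_zero, Finset.filter_eq_empty_iff]
    intro k _
    exact not_lt.2 (mul_pos (hposA a ha0 le_rfl k (by omega)) (hposA a ha0 le_rfl (k + 1) (by omega))).le
  have hfilt : (pathDet (fun _ => (1 : ℝ)) d (fun _ => (1 : ℝ)) f m).roots.filter (fun t => 0 < t ∧ t < b) =
      (pathDet (fun _ => (1 : ℝ)) d (fun _ => (1 : ℝ)) f m).roots.filter (fun t => a < t ∧ t < b) := by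
    refine Multiset.filter_congr fun t ht => ⟨fun h => ⟨?_, h.2⟩, fun h => ⟨ha0.trans h.1, h.2⟩⟩
    by_contra hle
    have hroot : (pathDet (fun _ => (1 : ℝ)) d (fun _ => (1 : ℝ)) f m).eval t = 0 := (mem_roots'.1 ht).2
    exact (hposA t h.1 (not_lt.1 hle) m le_rfl).ne' hroot
  rw [hfilt, ← hwin, hVa, add_zero]

/-- **THE RECESSIVE COUNT LAW, all sizes (conditional on NJAN-free zeros)**: all slopes positive, every zero of `D_m` in `(0,1)` non-degenerate and
without two negative pivot products three edges apart ⇒ the zeros of `D_m` in `(0,1)` counted with multiplicity number EXACTLY `⌊m/3⌋`. [this file] -/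
theorem card_roots_unit_interval_eq_div_three_of_sep (m : ℕ) (hm : 3 ≤ m)
    (hslope : ∀ k, k + 1 < m → d k + d (k + 1) < 2 * f k)
    (hnd : ∀ t, 0 < t → t < 1 → (pathDet (fun _ => (1 : ℝ)) d (fun _ => (1 : ℝ)) f m).eval t = 0 →
      ∀ k, 0 < k → k < m → (pathDet (fun _ => (1 : ℝ)) d (fun _ => (1 : ℝ)) f k).eval t ≠ 0)
    (hsep : ∀ t, 0 < t → t < 1 → (pathDet (fun _ => (1 : ℝ)) d (fun _ => (1 : ℝ)) f m).eval t = 0 → ∀ k, k + 4 < m →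
      (pathDet (fun _ => (1 : ℝ)) d (fun _ => (1 : ℝ)) f k).eval t * (pathDet (fun _ => (1 : ℝ)) d (fun _ => (1 : ℝ)) f (k + 1)).eval t < 0 →
      0 < (pathDet (fun _ => (1 : ℝ)) d (fun _ => (1 : ℝ)) f (k + 3)).eval t * (pathDet (fun _ => (1 : ℝ)) d (fun _ => (1 : ℝ)) f (k + 4)).eval t) :
    Multiset.card ((pathDet (fun _ => (1 : ℝ)) d (fun _ => (1 : ℝ)) f m).roots.filter (fun t => 0 < t ∧ t < 1)) = m / 3 := by
  have hev : ∀ᶠ x in 𝓝[<] (1 : ℝ), ∀ k ∈ range (m + 1),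
      0 < (if k % 6 < 3 then (1 : ℝ) else -1) * (pathDet (fun _ => (1 : ℝ)) d (fun _ => (1 : ℝ)) f k).eval x :=
    (Finset.eventually_all (range (m + 1))).2 fun k hk =>
      eventually_signTable_near_one d f m hslope k (by rw [mem_range] at hk; omega)
  obtain ⟨δ, hδ, hnear⟩ := exists_delta_of_eventually hev
  set b : ℝ := 1 - min δ 1 / 2 with hb_def
  have hb0 : 0 < b := by rw [hb_def]; have := min_le_right δ 1; linarith
  have hb1 : b < 1 := by rw [hb_def]; have := lt_min hδ one_pos; linarith
  have hsignAt : ∀ x, b ≤ x → x < 1 → ∀ k, k ≤ m →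
      0 < (if k % 6 < 3 then (1 : ℝ) else -1) * (pathDet (fun _ => (1 : ℝ)) d (fun _ => (1 : ℝ)) f k).eval x :=
    fun x hx1 hx2 k hk => hnear x (by rw [hb_def] at hx1; have := min_le_left δ 1; linarith) hx2 k (by rw [mem_range]; omega)
  obtain ⟨hV, hbne⟩ := sturmCount_of_signTable d f m b (hsignAt b le_rfl hb1)
  have hbelow := card_roots_below_eq_sturm d f m hm hb0 hb1 hslope hbne (fun t ht htb => hnd t ht (htb.trans hb1))
    (fun t ht htb => hsep t ht (htb.trans hb1))
  rw [hV] at hbelow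
  rw [← hbelow]
  congr 1
  refine Multiset.filter_congr fun t ht => ⟨fun h => ⟨h.1, ?_⟩, fun h => ⟨h.1, h.2.trans hb1⟩⟩
  by_contra hge
  have hroot : (pathDet (fun _ => (1 : ℝ)) d (fun _ => (1 : ℝ)) f m).eval t = 0 := (mem_roots'.1 ht).2
  have := hsignAt t (not_lt.1 hge) h.2 m le_rfl
  rw [hroot, mul_zero] at this
  exact lt_irrefl _ this

/-! ### 2. Distinct zeros: the laws in the census currency -/

/-- **simple zeros**: below the resonance, all slopes positive, `m ≤ 8`, every non-degenerate zero of `D_m` has root multiplicity one. [this file] -/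
theorem rootMultiplicity_eq_one_of_le_eight (m : ℕ) (hm : 3 ≤ m) (hm8 : m ≤ 8) (t : ℝ) (ht : 0 < t) (ht1 : t < 1)
    (hslope : ∀ k, k + 1 < m → d k + d (k + 1) < 2 * f k)
    (hroot : (pathDet (fun _ => (1 : ℝ)) d (fun _ => (1 : ℝ)) f m).eval t = 0)
    (hnd : ∀ k, 0 < k → k < m → (pathDet (fun _ => (1 : ℝ)) d (fun _ => (1 : ℝ)) f k).eval t ≠ 0) :
    (pathDet (fun _ => (1 : ℝ)) d (fun _ => (1 : ℝ)) f m).rootMultiplicity t = 1 := by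
  have hder := deriv_mul_prev_neg_below_one_of_le_eight d f m hm hm8 t ht ht1 hslope hroot hnd
  have hP0 : pathDet (fun _ => (1 : ℝ)) d (fun _ => (1 : ℝ)) f m ≠ 0 := by
    intro h0
    rw [h0, derivative_zero, eval_zero, zero_mul] at hder
    exact lt_irrefl _ hder
  have hpos : 0 < (pathDet (fun _ => (1 : ℝ)) d (fun _ => (1 : ℝ)) f m).rootMultiplicity t :=
    (rootMultiplicity_pos hP0).2 hroot
  have hle : ¬ 1 < (pathDet (fun _ => (1 : ℝ)) d (fun _ => (1 : ℝ)) f m).rootMultiplicity t := by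
    rw [one_lt_rootMultiplicity_iff_isRoot hP0]
    rintro ⟨-, h2⟩
    rw [IsRoot.def] at h2
    rw [h2, zero_mul] at hder
    exact lt_irrefl _ hder
  omega

/-- **THE RECESSIVE COUNT LAW in the census currency (`3 ≤ m ≤ 8`)**: the DISTINCT zeros of `D_m` in `(0,1)` number exactly `⌊m/3⌋`. [this file] -/
theorem card_posRoots_unit_interval_eq_div_three (m : ℕ) (hm : 3 ≤ m) (hm8 : m ≤ 8)
    (hslope : ∀ k, k + 1 < m → d k + d (k + 1) < 2 * f k)
    (hnd : ∀ t, 0 < t → t < 1 → (pathDet (fun _ => (1 : ℝ)) d (fun _ => (1 : ℝ)) f m).eval t = 0 →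
      ∀ k, 0 < k → k < m → (pathDet (fun _ => (1 : ℝ)) d (fun _ => (1 : ℝ)) f k).eval t ≠ 0) :
    (((pathDet (fun _ => (1 : ℝ)) d (fun _ => (1 : ℝ)) f m).roots.toFinset).filter (fun t => 0 < t ∧ t < 1)).card = m / 3 := by
  classical
  rw [← card_roots_unit_interval_eq_div_three d f m hm hm8 hslope hnd, ← Multiset.toFinset_filter]
  refine Multiset.toFinset_card_of_nodup ?_
  rw [Multiset.nodup_iff_count_le_one]
  intro t
  rw [Multiset.count_filter]
  split_ifs with h
  · rw [count_roots]
    by_cases hroot : (pathDet (fun _ => (1 : ℝ)) d (fun _ => (1 : ℝ)) f m).eval t = 0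
    · exact (rootMultiplicity_eq_one_of_le_eight d f m hm hm8 t h.1 h.2 hslope hroot (hnd t h.1 h.2 hroot)).le
    · rw [rootMultiplicity_eq_zero hroot]; exact Nat.zero_le _
  · exact Nat.zero_le _

end StaticTridiagonalRealUnit
end Summit.ValiantsHypothesis.ValiantsHypothesis.Theorems.KPlusLogSqLaw
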